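import Literature.AlgebraicGeometry.Modules.StalkPullbackFlat
import Literature.AlgebraicGeometry.Modules.TensorStalk
import Literature.AlgebraicGeometry.Modules.BoxTensor
import Literature.AlgebraicGeometry.Modules.TensorSheafHomAdjunction
import Literature.AlgebraicGeometry.Modules.InvertibleModule
import HarnessLib

/-!
# `N ↦ p^*G ⊗ q^*N` is an EXACT functor for a product `Z = X ×_k Y` over a field (Tor-independence of the projections)

Layer `Literature/AlgebraicGeometry/Modules`; sequel to `Modules/StalkPullbackFlat` (`(p^*G)_z` is flat over `𝒪_{Y,q z}`),
`Modules/TensorStalk` (`(N ⊗ M)_z ≅ N_z ⊗ M_z`, natural) and `Modules/PullbackStalk` (`(q^*N)_z ≅ 𝒪_{Z,z} ⊗_{𝒪_{Y,q z}} N_{q z}`, natural;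
monomorphisms are tested on stalks). For a cartesian square `IsPullback p q iX iY` of schemes over `Spec k`, `k` a field, and ANY
`𝒪_X`-module `G`, the functor
  `boxLeftFunctor p q G := Scheme.Modules.pullback q ⋙ (tensorBifunctor Z).obj ((Scheme.Modules.pullback p).obj G)`,
`N ↦ p^*G ⊗ q^*N = G ⊠ N`, PRESERVES MONOMORPHISMS (`preservesMonomorphisms_boxLeftFunctor`): on the stalk at `z` the map
`(𝟙 ⊗ q^*ι)_z` is `(p^*G)_z ⊗_{𝒪_{Z,z}} (𝒪_{Z,z} ⊗_{𝒪_{Y,q z}} ι_{q z}) = (p^*G)_z ⊗_{𝒪_{Y,q z}} ι_{q z}`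
(`cancelBaseChange`), injective because `(p^*G)_z` is flat over `𝒪_{Y,q z}`. Being a composite of two left adjoints it preserves finite
colimits, hence it is EXACT: `preservesFiniteLimits_boxLeftFunctor`, `preservesFiniteColimits_boxLeftFunctor`,
`preservesHomology_boxLeftFunctor` (theorems, not instances — bind with `haveI`). This is the sheaf form of «the projections of a
product over a field are Tor-independent» (EGA III 6.7; The Stacks Project Tag 08II), the input of «the external product of strictly
perfect resolutions resolves the external product» (`Modules/BoxTensorResolution`). Everything is proved; 0 named facts; no instances.

## References

* A. Grothendieck, *EGA III* (Publ. IHÉS 17, 1963), §6.7. [EGAIII2]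
* The Stacks Project, Tag 08II, Tag 0FXX. [StacksProject]
* U. Görtz, T. Wedhorn, *Algebraic Geometry I* (2nd ed. 2020), (7.8.6), (7.18.1). [GortzWedhorn2020]
-/

noncomputable section

-- `TopCat.Presheaf`/`Scheme.Modules` are not reducible (as in Mathlib's `AlgebraicGeometry/Modules`).
set_option backward.isDefEq.respectTransparency false

open CategoryTheory CategoryTheory.Limits AlgebraicGeometry TopologicalSpace Opposite
open scoped TensorProduct

universe u

namespace Literature.AlgebraicGeometry.Modules

variable {k : Type u} [Field k] {X Y Z : Scheme.{u}} {iX : X ⟶ Spec (.of k)} {iY : Y ⟶ Spec (.of k)}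

/-- **`N ↦ G ⊠ N = p^*G ⊗ q^*N`** as a functor `Y.Modules ⥤ Z.Modules` (for any span `p`, `q` and any `𝒪_X`-module `G`).
[cite: StacksProject, Tag 0FXX] -/
abbrev boxLeftFunctor (p : Z ⟶ X) (q : Z ⟶ Y) (G : X.Modules) : Y.Modules ⥤ Z.Modules :=
  Scheme.Modules.pullback q ⋙ (tensorBifunctor Z).obj ((Scheme.Modules.pullback p).obj G)

variable {p : Z ⟶ X} {q : Z ⟶ Y}

/-- **The stalk map of `𝟙_{p^*G} ⊗ q^*ι` is injective for a monomorphism `ι`** (`Z = X ×_k Y` over a field): through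
`(p^*G ⊗ q^*N)_z ≅ (p^*G)_z ⊗ (q^*N)_z` (`stalkTensorEquiv`, natural) and `(q^*N)_z ≅ 𝒪_{Z,z} ⊗_{𝒪_{Y,q z}} N_{q z}` (`stalkPullbackIso`, natural)
it is `(p^*G)_z ⊗_{𝒪_{Y,q z}} ι_{q z}` (`cancelBaseChange`), injective by the flatness of `(p^*G)_z` over `𝒪_{Y,q z}`
(`flat_stalk_pullback_of_isPullback`). [cite: EGAIII2, §6.7] [cite: StacksProject, Tag 08II] [cite: GortzWedhorn2020, (7.8.6)] -/
theorem stalkFunctor_map_boxLeft_injective (H : IsPullback p q iX iY) (G : X.Modules) (z : Z) {N' N : Y.Modules} (ι : N' ⟶ N)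
    [Mono ι] :
    Function.Injective ((stalkFunctor z).map ((boxLeftFunctor p q G).map ι)) := by
  let P : Z.Modules := (Scheme.Modules.pullback p).obj G
  let Oy : Type u := Y.presheaf.stalk (q z)
  let Oz : Type u := Z.presheaf.stalk z
  -- (1) through `stalkTensorEquiv`: it suffices that `𝟙 ⊗ (q^*ι)_z` is injective on `(p^*G)_z ⊗ (q^*N')_z`
  let ψ := (Scheme.Modules.pullback q).map ι
  suffices hinj : Function.Injective (((stalkFunctor z).map ψ).hom.lTensor (MStalk z P)) by
    intro v w hvw
    apply (stalkTensorEquiv P ((Scheme.Modules.pullback q).obj N') z).injective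
    apply hinj
    change TensorProduct.map LinearMap.id _ _ = TensorProduct.map LinearMap.id _ _
    rw [← stalkTensorEquiv_naturality_right, ← stalkTensorEquiv_naturality_right]
    exact congrArg _ hvw
  -- (2) through `stalkPullbackIso`: `(q^*ι)_z = e ≫ (𝒪_{Z,z} ⊗_{𝒪_{Y,q z}} ι_{q z}) ≫ e⁻¹`
  let e := stalkPullbackIso q z
  let E := ModuleCat.extendScalars.{u, u, u} (q.stalkMap z).hom
  have hnat : (stalkFunctor z).map ψ = e.hom.app N' ≫ E.map ((stalkFunctor (q z)).map ι) ≫ e.inv.app N := by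
    have h := e.hom.naturality ι
    calc (stalkFunctor z).map ψ
        = ((Scheme.Modules.pullback q ⋙ stalkFunctor z).map ι ≫ e.hom.app N) ≫ e.inv.app N := by
          rw [Category.assoc, Iso.hom_inv_id_app, Category.comp_id]; rfl
      _ = (e.hom.app N' ≫ (stalkFunctor (q z) ⋙ E).map ι) ≫ e.inv.app N := by rw [h]
      _ = _ := by rw [Category.assoc]; rfl
  rw [hnat, ModuleCat.hom_comp, ModuleCat.hom_comp, LinearMap.lTensor_comp, LinearMap.lTensor_comp]
  have h₁ : Function.Injective ((e.hom.app N').hom.lTensor (MStalk z P)) :=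
    (LinearEquiv.lTensor (MStalk z P) (e.app N').toLinearEquiv).injective
  have h₃ : Function.Injective ((e.inv.app N).hom.lTensor (MStalk z P)) :=
    (LinearEquiv.lTensor (MStalk z P) (e.app N).symm.toLinearEquiv).injective
  rw [LinearMap.coe_comp, LinearMap.coe_comp]
  refine h₃.comp (Function.Injective.comp ?_ h₁)
  -- (3) `(p^*G)_z ⊗_{𝒪_{Z,z}} (𝒪_{Z,z} ⊗_{𝒪_{Y,q z}} ι_{q z})` is `(p^*G)_z ⊗_{𝒪_{Y,q z}} ι_{q z}` up to `cancelBaseChange`, injective by flatness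
  letI algOyOz : Algebra Oy Oz := ((algebraMap Oz Oz).comp (q.stalkMap z).hom).toAlgebra
  letI modP : Module Oy (MStalk z P) := Module.compHom _ ((algebraMap Oz Oz).comp (q.stalkMap z).hom)
  haveI : IsScalarTower Oy Oz (MStalk z P) := IsScalarTower.of_algebraMap_smul fun _ _ => rfl
  haveI : Module.Flat Oy (MStalk z P) := flat_stalk_pullback_of_isPullback H G z
  have hι : Function.Injective ((stalkFunctor (q z)).map ι).hom := stalkFunctor_map_injective_of_mono ι (q z)
  have hflat : Function.Injective (TensorProduct.AlgebraTensorModule.lTensor Oz (MStalk z P) ((stalkFunctor (q z)).map ι).hom) :=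
    Module.Flat.lTensor_preserves_injective_linearMap (M := MStalk z P) _ hι
  have key := TensorProduct.AlgebraTensorModule.lTensor_comp_cancelBaseChange Oy Oz Oz (M := MStalk z P)
    ((stalkFunctor (q z)).map ι).hom
  -- `core ∘ cancel⁻¹ = cancel⁻¹ ∘ lTensor`, so `core` is injective
  have hcore : Function.Injective (TensorProduct.AlgebraTensorModule.lTensor Oz (MStalk z P)
      (TensorProduct.AlgebraTensorModule.lTensor Oz Oz ((stalkFunctor (q z)).map ι).hom)) := by
    rw [← (TensorProduct.AlgebraTensorModule.cancelBaseChange Oy Oz Oz (MStalk z P) (MStalk (q z) N)).injective.of_comp_iff,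
      ← LinearEquiv.coe_coe, ← LinearMap.coe_comp, ← key, LinearMap.coe_comp, LinearEquiv.coe_coe]
    exact hflat.comp (TensorProduct.AlgebraTensorModule.cancelBaseChange Oy Oz Oz (MStalk z P) (MStalk (q z) N')).injective
  exact hcore

omit [Field k] in
/-- `N ↦ p^*G ⊗ q^*N` is additive. [cite: StacksProject, Tag 0FXX] -/
theorem additive_boxLeftFunctor (p : Z ⟶ X) (q : Z ⟶ Y) (G : X.Modules) : (boxLeftFunctor p q G).Additive :=
  haveI := additive_tensorBifunctor_obj (X := Z) ((Scheme.Modules.pullback p).obj G)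
  inferInstance

/-- **`N ↦ p^*G ⊗ q^*N` preserves monomorphisms** (`Z = X ×_k Y` over a field; monomorphisms are tested on stalks).
[cite: EGAIII2, §6.7] [cite: StacksProject, Tag 08II] [cite: GortzWedhorn2020, (7.18.1)] -/
theorem preservesMonomorphisms_boxLeftFunctor (H : IsPullback p q iX iY) (G : X.Modules) : (boxLeftFunctor p q G).PreservesMonomorphisms where
  preserves ι _ := mono_of_stalkFunctor_map_injective _ fun z => stalkFunctor_map_boxLeft_injective H G z ι

/-- `N ↦ p^*G ⊗ q^*N` is a left adjoint (composite of `q^* ⊣ q_*` and `p^*G ⊗ – ⊣ 𝓗om(p^*G, –)`). [cite: StacksProject, Tag 0FXX with Tag 01CN] -/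
theorem isLeftAdjoint_boxLeftFunctor (p : Z ⟶ X) (q : Z ⟶ Y) (G : X.Modules) : (boxLeftFunctor p q G).IsLeftAdjoint :=
  haveI := isLeftAdjoint_tensorBifunctor_obj (X := Z) ((Scheme.Modules.pullback p).obj G)
  inferInstance

/-- `N ↦ p^*G ⊗ q^*N` preserves finite colimits (it is a left adjoint). [cite: StacksProject, Tag 0FXX] -/
theorem preservesFiniteColimits_boxLeftFunctor (p : Z ⟶ X) (q : Z ⟶ Y) (G : X.Modules) :
    PreservesFiniteColimits (boxLeftFunctor p q G) :=
  haveI := isLeftAdjoint_boxLeftFunctor p q G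
  inferInstance

/-- **`N ↦ p^*G ⊗ q^*N` is left exact** (`Z = X ×_k Y` over a field): right exact as a left adjoint and it preserves monomorphisms.
[cite: EGAIII2, §6.7] [cite: StacksProject, Tag 08II] -/
theorem preservesFiniteLimits_boxLeftFunctor (H : IsPullback p q iX iY) (G : X.Modules) : PreservesFiniteLimits (boxLeftFunctor p q G) :=
  haveI := preservesFiniteColimits_boxLeftFunctor p q G
  haveI := additive_boxLeftFunctor p q G
  (Functor.preservesFiniteLimits_iff_forall_exact_map_and_mono _).mpr fun S hS =>
    haveI := hS.mono_f
    ⟨((Functor.preservesFiniteColimits_iff_forall_exact_map_and_epi _).mp inferInstance S hS).1,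
      (preservesMonomorphisms_boxLeftFunctor H G).preserves S.f⟩

/-- **`N ↦ p^*G ⊗ q^*N` is exact** (preserves homology: kernels, cokernels, exactness of short complexes, quasi-isomorphisms of
complexes), for `Z = X ×_k Y` over a field and any `𝒪_X`-module `G`. [cite: EGAIII2, §6.7] [cite: StacksProject, Tag 08II] -/
theorem preservesHomology_boxLeftFunctor (H : IsPullback p q iX iY) (G : X.Modules) :
    haveI := additive_boxLeftFunctor p q G
    (boxLeftFunctor p q G).PreservesHomology :=
  haveI := additive_boxLeftFunctor p q G
  haveI := preservesFiniteLimits_boxLeftFunctor H G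
  haveI := preservesFiniteColimits_boxLeftFunctor p q G
  inferInstance

end Literature.AlgebraicGeometry.Modules

end
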